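import Mathlib
import HarnessLib
import Literature.Analysis.PDE.LaplacianInequalities
import Literature.Analysis.Calculus.PlaneIsoparametric

/-!
# Isoparametric functions in the plane, II: the level curves are CONCENTRIC CIRCLES where `λ₂ ≠ 0`
# (Levi-Civita–Segre theorem in `ℝ²`, circle case) [cite: CecilRyan1985, Ch. 3 §5] [cite: Segre1938Isoparametric]

Analysis/Calculus support file (everything proved, no named facts), sequel of `PlaneIsoparametric` (pointwise Hessian
structure `D²W = λ₁ n⊗n + λ₂ τ⊗τ` and the integrability identity `a λ₂′ = λ₂(λ₁ − λ₂)` of a planar isoparametric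
function `W`: `(∂₀W)² + (∂₁W)² = a(W)`, `∂₀∂₀W + ∂₁∂₁W = b(W)`, `λ₁ = a′/2`, `λ₂ = b − a′/2`).

* `fderiv_centre_eq_zero` — the CENTRE MAP `cᵢ(y) = yᵢ − ∂ᵢW(y)/λ₂(W y)` has zero derivative at every point of the
  open set where `∇W ≠ 0` and `λ₂(W) ≠ 0` (from the centre-map derivative of file I and the integrability identity).
* `exists_centre_of_isoparametric` — **CONCENTRIC CIRCLES**: if `W` is `C³` on an open `U`, isoparametric there with
  `a ∈ C²`, `b ∈ C¹`, and `x ∈ U` has `∇W(x) ≠ 0`, `λ₂(W x) ≠ 0`, then for some centre `c ∈ ℝ²` and some ball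
  `B(x,ε) ⊆ U`: `∇W(y) = λ₂(W y)·(y − c)` for all `y ∈ B(x,ε)` — the gradient is radial from `c`, the level curves are
  arcs of circles centred at `c`, `|∇W|` is constant on each [cite: CecilRyan1985, Ch. 3 §5] (Levi-Civita 1937 for
  surfaces in `ℝ³`, Segre 1938 [cite: Segre1938Isoparametric] in `ℝⁿ`; the planar case goes back to Somigliana).

The complementary case `λ₂ ≡ 0` (parallel straight level lines) and the dichotomy are in part III.

Consumer: the structural route to the poloidal Type-I Liouville crux of `Summits/NavierStokesRegularity` (crux
`PoloidalWindowRigidity` / item `LrcModEntire`): an isoparametric vortex-line foliation of a horizontal slice is, by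
this theorem, a family of concentric circles, i.e. the vorticity carries the rotation germ about a vertical axis.

WHAT THIS IS NOT: no statement in dimension `≥ 3`; no global (maximal-domain) statement.
-/

noncomputable section

/-! ### §5. The centre map is locally constant where `λ₂ ≠ 0`: the level curves are CONCENTRIC CIRCLES -/

namespace Literature.Analysis.Calculus.PlaneIsoparametric

open Set Function Filter InnerProductSpace Metric
open scoped Laplacian ContDiff
open _root_.Topology

section Circles

variable {W : EuclideanSpace ℝ (Fin 2) → ℝ} {a b : ℝ → ℝ} {U : Set (EuclideanSpace ℝ (Fin 2))}
  {x : EuclideanSpace ℝ (Fin 2)}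

/-- The derivative of the coordinate function `y ↦ yᵢ` on `EuclideanSpace ℝ (Fin 2)` along `eⱼ` is `δᵢⱼ`. [folklore] -/
private theorem fderiv_coord_apply_single (y : EuclideanSpace ℝ (Fin 2)) (i j : Fin 2) :
    fderiv ℝ (fun z : EuclideanSpace ℝ (Fin 2) => z i) y (EuclideanSpace.single j 1) = if i = j then 1 else 0 := by
  have h : HasFDerivAt (fun z : EuclideanSpace ℝ (Fin 2) => z i)
      (EuclideanSpace.proj (𝕜 := ℝ) i : EuclideanSpace ℝ (Fin 2) →L[ℝ] ℝ) y :=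
    (EuclideanSpace.proj (𝕜 := ℝ) i).hasFDerivAt
  rw [h.fderiv]
  simp

/-- **THE CENTRE MAP HAS ZERO DERIVATIVE** (pointwise).  Under the hypotheses of `integrability_of_isoparametric`,
at a point `x ∈ U` where `λ₂(W x) = b(W x) − a′(W x)/2 ≠ 0`, each component of the centre map
`cᵢ(y) := yᵢ − ∂ᵢW(y)/λ₂(W y)` has `∂ⱼcᵢ(x) = 0`. [cite: CecilRyan1985, Ch. 3 §5] [cite: Segre1938Isoparametric] -/
theorem fderiv_centre_eq_zero (hU : IsOpen U) (hx : x ∈ U) (hW : ContDiffOn ℝ 3 W U)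
    (ha : ContDiff ℝ 2 a) (hb : ContDiff ℝ 1 b)
    (h₁ : ∀ y ∈ U, (fderiv ℝ W y (EuclideanSpace.single 0 1)) ^ 2 +
      (fderiv ℝ W y (EuclideanSpace.single 1 1)) ^ 2 = a (W y))
    (h₂ : ∀ y ∈ U, fderiv ℝ (fun z => fderiv ℝ W z (EuclideanSpace.single 0 1)) y (EuclideanSpace.single 0 1) +
      fderiv ℝ (fun z => fderiv ℝ W z (EuclideanSpace.single 1 1)) y (EuclideanSpace.single 1 1) = b (W y))
    (hpos : 0 < a (W x)) (hL : b (W x) - deriv a (W x) / 2 ≠ 0) (i j : Fin 2) :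
    fderiv ℝ (fun y : EuclideanSpace ℝ (Fin 2) =>
        y i - fderiv ℝ W y (EuclideanSpace.single i 1) / (b (W y) - deriv a (W y) / 2)) x
      (EuclideanSpace.single j 1) = 0 := by
  have hUx : U ∈ 𝓝 x := hU.mem_nhds hx
  have hW2 : ContDiffAt ℝ 2 W x := (hW.contDiffAt hUx).of_le (by norm_num)
  have hWd : DifferentiableAt ℝ W x := hW2.differentiableAt (by norm_num)
  have ha1 : Differentiable ℝ a := ha.differentiable (by norm_num)
  have hda : ContDiff ℝ 1 (deriv a) := by
    have h := (contDiff_succ_iff_deriv (n := 1) (f := a)).1 (by simpa [one_add_one_eq_two] using ha)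
    exact h.2.2
  have hda1 : Differentiable ℝ (deriv a) := hda.differentiable one_ne_zero
  have hb1 : Differentiable ℝ b := hb.differentiable one_ne_zero
  -- the function L = λ₂ ∘ W and its derivative
  have hLd : HasFDerivAt (fun y => b (W y) - deriv a (W y) / 2)
      ((deriv b (W x) - deriv (deriv a) (W x) / 2) • fderiv ℝ W x) x := by
    have h1 : HasFDerivAt (fun y => b (W y)) (deriv b (W x) • fderiv ℝ W x) x :=
      (hb1 (W x)).hasDerivAt.comp_hasFDerivAt x hWd.hasFDerivAt
    have h2 : HasFDerivAt (fun y => deriv a (W y)) (deriv (deriv a) (W x) • fderiv ℝ W x) x :=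
      (hda1 (W x)).hasDerivAt.comp_hasFDerivAt x hWd.hasFDerivAt
    have hfun : (fun y => b (W y) - deriv a (W y) / 2) = fun y => b (W y) - (1 / 2 : ℝ) * deriv a (W y) := by
      funext y; ring
    rw [hfun]
    refine (h1.sub (h2.const_mul (1 / 2 : ℝ))).congr_fderiv ?_
    ext v
    simp only [_root_.sub_apply, FunLike.coe_smul, Pi.smul_apply, smul_eq_mul]
    ring
  have hLdiff : DifferentiableAt ℝ (fun y => b (W y) - deriv a (W y) / 2) x := hLd.differentiableAt
  -- derivative of the centre-map component from §3, with L := λ₂ ∘ W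
  have hev : ∀ᶠ y in 𝓝 x, (fderiv ℝ W y (EuclideanSpace.single 0 1)) ^ 2 +
      (fderiv ℝ W y (EuclideanSpace.single 1 1)) ^ 2 = a (W y) := by
    filter_upwards [hUx] with y hy using h₁ y hy
  have hm := fderiv_centreMap_of_isoparametric hW2 (ha1 (W x)).hasDerivAt hev (h₂ x hx) hLdiff rfl hL i j
  -- the integrability identity at x
  have hF2 := integrability_of_isoparametric hU hx hW ha hb h₁ h₂ hpos
  -- evaluate ∂ⱼL = λ₂′(W) ∂ⱼW
  have hLj : fderiv ℝ (fun y => b (W y) - deriv a (W y) / 2) x (EuclideanSpace.single j 1) =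
      (deriv b (W x) - deriv (deriv a) (W x) / 2) * fderiv ℝ W x (EuclideanSpace.single j 1) := by
    rw [hLd.fderiv]; simp [smul_eq_mul]
  rw [hLj, h₁ x hx] at hm
  -- differentiability of the pieces of cᵢ
  have hPd : DifferentiableAt ℝ (fun y => fderiv ℝ W y (EuclideanSpace.single i 1)) x := by
    have h := (hW2.fderiv_right (m := 1) (by norm_num)).differentiableAt (by norm_num)
    exact (ContinuousLinearMap.apply ℝ ℝ (EuclideanSpace.single i (1 : ℝ))).differentiableAt.comp x h
  have hinv : HasFDerivAt (fun y => (b (W y) - deriv a (W y) / 2)⁻¹)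
      ((-((b (W x) - deriv a (W x) / 2) ^ 2)⁻¹) • fderiv ℝ (fun y => b (W y) - deriv a (W y) / 2) x) x := by
    have h := (hasDerivAt_inv hL).comp_hasFDerivAt x hLdiff.hasFDerivAt
    simpa [Function.comp_def] using h
  have hmd : DifferentiableAt ℝ
      (fun y => fderiv ℝ W y (EuclideanSpace.single i 1) * (b (W y) - deriv a (W y) / 2)⁻¹) x :=
    (hPd.hasFDerivAt.mul hinv).differentiableAt
  have hcd : DifferentiableAt ℝ (fun y : EuclideanSpace ℝ (Fin 2) => y i) x :=
    (EuclideanSpace.proj (𝕜 := ℝ) i).differentiableAt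
  have hfun : (fun y : EuclideanSpace ℝ (Fin 2) =>
      y i - fderiv ℝ W y (EuclideanSpace.single i 1) / (b (W y) - deriv a (W y) / 2)) =
      fun y => y i - fderiv ℝ W y (EuclideanSpace.single i 1) * (b (W y) - deriv a (W y) / 2)⁻¹ := by
    funext y; rw [div_eq_mul_inv]
  have hfun2 : (fun y : EuclideanSpace ℝ (Fin 2) =>
      fderiv ℝ W y (EuclideanSpace.single i 1) / (b (W y) - deriv a (W y) / 2)) =
      fun y => fderiv ℝ W y (EuclideanSpace.single i 1) * (b (W y) - deriv a (W y) / 2)⁻¹ := by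
    funext y; rw [div_eq_mul_inv]
  rw [hfun2] at hm
  rw [hfun, fderiv_fun_sub hcd hmd, _root_.sub_apply, fderiv_coord_apply_single]
  -- it remains: ∂ⱼ mᵢ = δᵢⱼ, from hm and hF2 (A ≠ 0, L ≠ 0)
  set A := a (W x) with hA
  set Λ := b (W x) - deriv a (W x) / 2 with hΛ
  set M := fderiv ℝ (fun y => fderiv ℝ W y (EuclideanSpace.single i 1) * (b (W y) - deriv a (W y) / 2)⁻¹) x
      (EuclideanSpace.single j 1) with hM
  have hAne : A ≠ 0 := hpos.ne'
  have hAL : A * Λ ^ 2 ≠ 0 := mul_ne_zero hAne (pow_ne_zero 2 hL)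
  have key : A * Λ ^ 2 * (M - (if i = j then 1 else 0)) = 0 := by
    have hF2' : A * (deriv b (W x) - deriv (deriv a) (W x) / 2) = Λ * (deriv a (W x) / 2 - Λ) := hF2
    linear_combination hm - fderiv ℝ W x (EuclideanSpace.single i 1) * fderiv ℝ W x (EuclideanSpace.single j 1) * hF2'
  have := (mul_eq_zero.1 key).resolve_left hAL
  linarith

end Circles

end Literature.Analysis.Calculus.PlaneIsoparametric

namespace Literature.Analysis.Calculus.PlaneIsoparametric

open Set Function Filter InnerProductSpace Metric
open scoped Laplacian ContDiff
open _root_.Topology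

section Radial

variable {W : EuclideanSpace ℝ (Fin 2) → ℝ} {a b : ℝ → ℝ} {U : Set (EuclideanSpace ℝ (Fin 2))}
  {x : EuclideanSpace ℝ (Fin 2)}

/-- A vector of `ℝ²` in the standard basis. [folklore] -/
private theorem eq_sum_two (v : EuclideanSpace ℝ (Fin 2)) :
    v = v 0 • (EuclideanSpace.single 0 (1 : ℝ) : EuclideanSpace ℝ (Fin 2)) +
      v 1 • (EuclideanSpace.single 1 (1 : ℝ) : EuclideanSpace ℝ (Fin 2)) := by
  ext i
  fin_cases i <;> simp

/-- A continuous linear functional on `ℝ²` vanishing on `e₀, e₁` is zero. [folklore] -/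
private theorem clm_eq_zero_of_single {f : EuclideanSpace ℝ (Fin 2) →L[ℝ] ℝ}
    (h : ∀ j : Fin 2, f (EuclideanSpace.single j 1) = 0) : f = 0 := by
  ext v
  rw [eq_sum_two v, map_add, map_smul, map_smul, h 0, h 1]
  simp

/-- **CONCENTRIC CIRCLES (Levi-Civita–Segre in the plane, the case `λ₂ ≠ 0`).**  Let `W` be `C³` on an open set
`U ⊆ ℝ²` with `(∂₀W)² + (∂₁W)² = a(W)` and `∂₀∂₀W + ∂₁∂₁W = b(W)` on `U` (`a ∈ C²`, `b ∈ C¹`), and let `x ∈ U` with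
`∇W(x) ≠ 0` (i.e. `a(W x) > 0`) and `λ₂(W x) = b(W x) − a′(W x)/2 ≠ 0`.  Then there are a CENTRE `c ∈ ℝ²` and a
ball `B(x, ε) ⊆ U` on which `∇W(y) = λ₂(W y) · (y − c)`: the gradient is radial from `c`, so the level curves of
`W` in the ball are arcs of circles centred at `c` (and `|∇W|` is constant on each of them).
[cite: CecilRyan1985, Ch. 3 §5] [cite: Segre1938Isoparametric] -/
theorem exists_centre_of_isoparametric (hU : IsOpen U) (hx : x ∈ U) (hW : ContDiffOn ℝ 3 W U)
    (ha : ContDiff ℝ 2 a) (hb : ContDiff ℝ 1 b)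
    (h₁ : ∀ y ∈ U, (fderiv ℝ W y (EuclideanSpace.single 0 1)) ^ 2 +
      (fderiv ℝ W y (EuclideanSpace.single 1 1)) ^ 2 = a (W y))
    (h₂ : ∀ y ∈ U, fderiv ℝ (fun z => fderiv ℝ W z (EuclideanSpace.single 0 1)) y (EuclideanSpace.single 0 1) +
      fderiv ℝ (fun z => fderiv ℝ W z (EuclideanSpace.single 1 1)) y (EuclideanSpace.single 1 1) = b (W y))
    (hpos : 0 < a (W x)) (hL : b (W x) - deriv a (W x) / 2 ≠ 0) :
    ∃ (c : EuclideanSpace ℝ (Fin 2)) (ε : ℝ), 0 < ε ∧ ball x ε ⊆ U ∧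
      (∀ y ∈ ball x ε, b (W y) - deriv a (W y) / 2 ≠ 0) ∧
      ∀ y ∈ ball x ε, ∀ i : Fin 2,
        fderiv ℝ W y (EuclideanSpace.single i 1) = (b (W y) - deriv a (W y) / 2) * (y i - c i) := by
  -- ## a ball inside `U` on which `a(W) > 0` and `λ₂(W) ≠ 0`
  have hUx : U ∈ 𝓝 x := hU.mem_nhds hx
  have hWc : ContinuousAt W x := (hW.contDiffAt hUx).continuousAt
  have hac : Continuous a := ha.continuous
  have hda : ContDiff ℝ 1 (deriv a) := by
    have h := (contDiff_succ_iff_deriv (n := 1) (f := a)).1 (by simpa [one_add_one_eq_two] using ha)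
    exact h.2.2
  have hLc : ContinuousAt (fun y => b (W y) - deriv a (W y) / 2) x :=
    ((hb.continuous.continuousAt.comp hWc).sub ((hda.continuous.continuousAt.comp hWc).div_const 2))
  have hApc : ContinuousAt (fun y => a (W y)) x := hac.continuousAt.comp hWc
  have hev : ∀ᶠ y in 𝓝 x, y ∈ U ∧ 0 < a (W y) ∧ b (W y) - deriv a (W y) / 2 ≠ 0 := by
    filter_upwards [hUx, hApc.eventually (lt_mem_nhds hpos), hLc.eventually_ne hL] with y h1 h2 h3
    exact ⟨h1, h2, h3⟩
  obtain ⟨ε, hε, hball⟩ := Metric.eventually_nhds_iff_ball.1 hev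
  -- ## the centre components are constant on the ball
  set cfun : Fin 2 → EuclideanSpace ℝ (Fin 2) → ℝ := fun i y =>
    y i - fderiv ℝ W y (EuclideanSpace.single i 1) / (b (W y) - deriv a (W y) / 2) with hcfun
  have hderiv0 : ∀ i, ∀ y ∈ ball x ε, fderiv ℝ (cfun i) y = 0 := by
    intro i y hy
    obtain ⟨hyU, hypos, hyL⟩ := hball y hy
    exact clm_eq_zero_of_single fun j => fderiv_centre_eq_zero hU hyU hW ha hb h₁ h₂ hypos hyL i j
  have hdiff : ∀ i, ∀ y ∈ ball x ε, DifferentiableAt ℝ (cfun i) y := by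
    intro i y hy
    obtain ⟨hyU, hypos, hyL⟩ := hball y hy
    have hW2 : ContDiffAt ℝ 2 W y := (hW.contDiffAt (hU.mem_nhds hyU)).of_le (by norm_num)
    have hWd : DifferentiableAt ℝ W y := hW2.differentiableAt (by norm_num)
    have hPd : DifferentiableAt ℝ (fun z => fderiv ℝ W z (EuclideanSpace.single i 1)) y := by
      have h := (hW2.fderiv_right (m := 1) (by norm_num)).differentiableAt (by norm_num)
      exact (ContinuousLinearMap.apply ℝ ℝ (EuclideanSpace.single i (1 : ℝ))).differentiableAt.comp y h
    have hLd : DifferentiableAt ℝ (fun z => b (W z) - deriv a (W z) / 2) y := by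
      have h1 : DifferentiableAt ℝ (fun z => b (W z)) y := ((hb.differentiable one_ne_zero) (W y)).comp y hWd
      have h2 : DifferentiableAt ℝ (fun z => deriv a (W z)) y :=
        ((hda.differentiable one_ne_zero) (W y)).comp y hWd
      have hfun2 : (fun z => b (W z) - deriv a (W z) / 2) = fun z => b (W z) - deriv a (W z) * (2 : ℝ)⁻¹ := by
        funext z; rw [div_eq_mul_inv]
      rw [hfun2]
      exact h1.sub (h2.mul_const _)
    have hinv : DifferentiableAt ℝ (fun z => (b (W z) - deriv a (W z) / 2)⁻¹) y :=
      ((hasDerivAt_inv hyL).comp_hasFDerivAt y hLd.hasFDerivAt).differentiableAt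
    have hq : DifferentiableAt ℝ
        (fun z => fderiv ℝ W z (EuclideanSpace.single i 1) * (b (W z) - deriv a (W z) / 2)⁻¹) y := hPd.mul hinv
    have hfun : cfun i = fun z => z i - fderiv ℝ W z (EuclideanSpace.single i 1) * (b (W z) - deriv a (W z) / 2)⁻¹ := by
      funext z; simp only [hcfun, div_eq_mul_inv]
    rw [hfun]
    exact (EuclideanSpace.proj (𝕜 := ℝ) i).differentiableAt.sub hq
  have hconst : ∀ i, ∀ y ∈ ball x ε, cfun i y = cfun i x := by
    intro i y hy
    have hconv : Convex ℝ (ball x ε) := convex_ball x ε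
    have hdo : DifferentiableOn ℝ (cfun i) (ball x ε) := fun z hz => (hdiff i z hz).differentiableWithinAt
    have hzero : ∀ z ∈ ball x ε, fderivWithin ℝ (cfun i) (ball x ε) z = 0 := by
      intro z hz
      rw [fderivWithin_of_isOpen isOpen_ball hz]
      exact hderiv0 i z hz
    exact hconv.is_const_of_fderivWithin_eq_zero hdo hzero hy (mem_ball_self hε)
  -- ## the centre
  refine ⟨WithLp.toLp 2 fun i => cfun i x, ε, hε, fun y hy => (hball y hy).1, fun y hy => (hball y hy).2.2, ?_⟩
  intro y hy i
  obtain ⟨hyU, hypos, hyL⟩ := hball y hy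
  have hc := hconst i y hy
  simp only [hcfun] at hc
  have hci : (WithLp.toLp 2 fun i => cfun i x : EuclideanSpace ℝ (Fin 2)) i = cfun i x := rfl
  rw [hci]
  simp only [hcfun]
  rw [← hc]
  have hyL2 : b (W y) * 2 - deriv a (W y) ≠ 0 := fun h => hyL (by linarith)
  field_simp
  ring

end Radial

end Literature.Analysis.Calculus.PlaneIsoparametric

end
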